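import Literature.NumberTheory.Automorphic.LocalUnitaryIntegralLevel
import Literature.NumberTheory.Automorphic.LocalStableConjSplitPlace
import Literature.NumberTheory.Automorphic.QuadraticAdeleBaseChange
import Literature.LinearAlgebra.Matrix.IntegralConjugacyOfRegularElements
import Mathlib.Algebra.Polynomial.Lifts
import HarnessLib

/-!
# Kottwitz's orbit lemma for `U(J)(F_v)` at the SPLIT places: `{y ∣ y γ_v y⁻¹ ∈ U(J)(𝒪_v)} = U(J)(𝒪_v) · Z(γ_v)` for almost every split `v`
(Kottwitz, *Stable trace formula: elliptic singular terms* (1986), Prop. 7.1 ∕ Cor. 7.3, the places of `F` split in `E`, where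
`U(J)(F_v) ≅ GL_N(E_w)` and `U(J)(𝒪_v) ≅ GL_N(𝒪_w)`; Rogawski (1990), §3.3 p. 21, §4.3 p. 44)

Topic `NumberTheory/Automorphic`; namespace `Literature.NumberTheory.Automorphic.UnitaryGroup` (§2–§4) and `Literature.NumberTheory.Automorphic`
(§1); THEOREMS ONLY (no definition, no instance, no named fact, no `sorry`).  Second repayment instalment of the named fact ★-to-be
`UnitaryGroup.UnramifiedOrbitSetAE` (`Automorphic/UnramifiedOrbitalUnitFactor`): its conclusion at the places of `F = L⁺` that SPLIT in `E = L`,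
by transport of the `GL_N` statement ★ `Literature.LinearAlgebra.Matrix.mem_range_map_mul_centralizer_of_conj_mem_range` (integral conjugacy of
matrices with separable reduction over the local ring `𝒪_w`) along ★ `localSplitEquiv : U(J)(F_v) ≃ₜ* GL_N(E_w)` and ★ `mem_localIntegralLevel_iff_of_ne`
(`U(J)(𝒪_v) ↔ GL_N(𝒪_w)`).  The NON-split places (the genuine unitary case: norm surjectivity on the commutant order) are a separate file.

* §1 (generic): `orbitSet_of_mulEquiv` — the orbit-set property `∀ y, y γ y⁻¹ ∈ K → y ∈ K · Z(γ)` transports along a group isomorphism matching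
  the subgroups; `mem_range_map_adicCompletionIntegers_iff_mem_glInt` — ★ `glInt N (E_w)` IS the image of `GL_N(𝒪_w)` for Mathlib's valuation
  subring `𝒪_w = w.adicCompletionIntegers E` (a local ring); `eventually_mem_adicCompletionIntegers` ∕ `eventually_exists_map_eq_map` ∕
  **`eventually_exists_separable_lift`** — an element ∕ a polynomial over the number field `E` is `w`-integral at almost every `w`, and a SEPARABLE
  `p ∈ E[X]` has, at almost every `w`, an integral model `p̃ ∈ 𝒪_w[X]` which is separable over `𝒪_w` (Bezout `a p + b p′ = 1` made integral), hence
  separable modulo `𝔪_w` (★ `Polynomial.Separable.map`).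
* §2 (generic `E/F`, `c`, `J`; a split place `w ∣ v`, `c • w ≠ w`, `J_w ∈ GL_N(𝒪_w)`): `localSplitEquiv_eq_map_of_eq_toLocalGL` (over ★
  `coe_localSplitEquiv_apply`) (for `g = γ ⊗ 1`, `γ ∈ GL_N(E)`: `localSplitEquiv g = γ` read in `GL_N(E_w)`), and
  **`orbitSet_of_split`** — if `γ ⊗ 1 ∈ U(J)(F_v)` with `γ_w ∈ GL_N(𝒪_w)` of characteristic polynomial with a separable integral model, then
  `∀ y ∈ U(J)(F_v), y (γ ⊗ 1) y⁻¹ ∈ U(J)(𝒪_v) → y ∈ U(J)(𝒪_v) · Z(γ ⊗ 1)`.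
* §3 **`eventually_forall_orbitSet_of_split`** — for `c ≠ 1`, `J` `c`-hermitian with `det J` a unit, and `γ ∈ GL_N(E)` with SEPARABLE characteristic
  polynomial such that `γ ⊗ 1 ∈ U(J)(F_v)` for every `v` (given as elements `g v` with `(g v : GL_N(E_v)) = γ ⊗ 1`): for all but finitely many `v`, at
  EVERY split `w ∣ v` the orbit-set property holds at `g v` (exceptional set: `γ_w ∉ GL_N(𝒪_w)`, `J_w ∉ GL_N(𝒪_w)`, or no separable integral model).
* §4 CM dress (`F = L⁺`, `E = L`, `c` = complex conjugation; carriers `(cmDatum L N H).Local v`, levels ★ `cmLocalIntegralLevel`):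
  `coe_cmDatum_toLocal_toAdelic` (`(γ_v : GL_N(L ⊗ L⁺_v)) = γ ⊗ 1`) and **`eventually_forall_orbitSet_cmDatum_of_split`** — for a hermitian `H` with
  `det H ≠ 0` and a regular semisimple rational `γ ∈ U(H)(L⁺)` (★ `IsRegularElt` unfolded): for almost every `v`, at every split `w ∣ v`,
  `∀ y : (cmDatum L N H).Local v, y γ_v y⁻¹ ∈ K_v → y ∈ K_v · Z(γ_v)` — the SPLIT half of `UnramifiedOrbitSetAE L N H`.

## References
* R. E. Kottwitz, *Stable trace formula: elliptic singular terms*, Math. Ann. 275 (1986), §7, Prop. 7.1, Cor. 7.3 [Kottwitz1986].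
* J. D. Rogawski, *Automorphic Representations of Unitary Groups in Three Variables*, Ann. of Math. Stud. 123 (1990), §3.3 p. 21, §4.3 p. 44 (print)
  [Rogawski1990].
* V. Platonov, A. Rapinchuk, *Algebraic Groups and Number Theory* (1994), §5.1 (`G_{𝒪_v}` at almost every place) [PlatonovRapinchuk1994].
-/

set_option autoImplicit false

noncomputable section

open NumberField IsDedekindDomain Filter Polynomial
open scoped Matrix Pointwise

namespace Literature.NumberTheory.Automorphic

/-! ## §1 Generic: transport of the orbit-set property; `GL_N(𝒪_w)`; integral separable models at almost every place -/

section Transport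

variable {G G' : Type*} [Group G] [Group G']

/-- **The orbit-set property transports along a group isomorphism matching the subgroups**: if `e : G ≃* G'`, `g ∈ K ↔ e g ∈ K'` for all
`g`, and `{y' ∣ y' (e γ) y'⁻¹ ∈ K'} ⊆ K' · Z(e γ)`, then `{y ∣ y γ y⁻¹ ∈ K} ⊆ K · Z(γ)`. [cite: Kottwitz1986, Prop. 7.1] -/
theorem orbitSet_of_mulEquiv (e : G ≃* G') (K : Subgroup G) (K' : Subgroup G') (hK : ∀ g, g ∈ K ↔ e g ∈ K') (γ : G)
    (h : ∀ y' : G', y' * e γ * y'⁻¹ ∈ K' → y' ∈ (K' : Set G') * (Subgroup.centralizer ({e γ} : Set G') : Set G')) :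
    ∀ y : G, y * γ * y⁻¹ ∈ K → y ∈ (K : Set G) * (Subgroup.centralizer ({γ} : Set G) : Set G) := by
  intro y hy
  have hy' : e y * e γ * (e y)⁻¹ ∈ K' := by
    rw [← map_mul, ← map_inv, ← map_mul]
    exact (hK _).1 hy
  obtain ⟨k', hk', z', hz', hkz⟩ := Set.mem_mul.1 (h (e y) hy')
  refine Set.mem_mul.2 ⟨e.symm k', (hK _).2 (by rwa [e.apply_symm_apply]), e.symm z', ?_, ?_⟩
  · rw [SetLike.mem_coe, Subgroup.mem_centralizer_singleton_iff] at hz' ⊢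
    apply e.injective
    rw [map_mul, map_mul, e.apply_symm_apply, hz']
  · apply e.injective
    rw [map_mul, e.apply_symm_apply, e.apply_symm_apply, hkz]

end Transport

section Integers

variable {E : Type} [Field E] [NumberField E] (N : ℕ)

/-- **`GL_N(𝒪_w)` is the image of `GL_N` of the valuation subring**: `g ∈ glInt N (E_w)` (★: entries of `g` and `g⁻¹` integral) iff
`g = k ⊗ 1` for some `k ∈ GL_N(w.adicCompletionIntegers E)` (Mathlib's valuation subring, a local ring). [cite: PlatonovRapinchuk1994, §5.1] -/
theorem mem_range_map_adicCompletionIntegers_iff_mem_glInt (w : HeightOneSpectrum (𝓞 E)) (g : GL (Fin N) (w.adicCompletion E)) :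
    g ∈ (Matrix.GeneralLinearGroup.map (n := Fin N) (w.adicCompletionIntegers E).subtype).range ↔ g ∈ glInt N (w.adicCompletion E) := by
  rw [UnitaryGroup.mem_glInt_adicCompletion_iff]
  constructor
  · rintro ⟨u, rfl⟩
    refine ⟨fun i j => ?_, fun i j => ?_⟩
    · exact (u.1 i j).2
    · rw [← map_inv]
      exact (u⁻¹.1 i j).2
  · rintro ⟨hg, hg'⟩
    have hinj : Function.Injective ((w.adicCompletionIntegers E).subtype.mapMatrix :
        Matrix (Fin N) (Fin N) (w.adicCompletionIntegers E) → Matrix (Fin N) (Fin N) (w.adicCompletion E)) :=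
      Matrix.map_injective Subtype.val_injective
    let A : Matrix (Fin N) (Fin N) (w.adicCompletionIntegers E) := Matrix.of fun i j => ⟨_, hg i j⟩
    let B : Matrix (Fin N) (Fin N) (w.adicCompletionIntegers E) := Matrix.of fun i j => ⟨_, hg' i j⟩
    have hA : (w.adicCompletionIntegers E).subtype.mapMatrix A = (g : Matrix (Fin N) (Fin N) (w.adicCompletion E)) := rfl
    have hB : (w.adicCompletionIntegers E).subtype.mapMatrix B =
        ((g⁻¹ : GL (Fin N) (w.adicCompletion E)) : Matrix (Fin N) (Fin N) (w.adicCompletion E)) := rfl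
    refine ⟨⟨A, B, hinj ?_, hinj ?_⟩, ?_⟩
    · rw [map_mul, map_one, hA, hB, ← Units.val_mul, mul_inv_cancel, Units.val_one]
    · rw [map_mul, map_one, hA, hB, ← Units.val_mul, inv_mul_cancel, Units.val_one]
    · exact Units.ext hA

/-- **An element of `E` is `w`-integral at almost every place `w`.** [cite: PlatonovRapinchuk1994, §5.1] -/
theorem eventually_mem_adicCompletionIntegers (x : E) :
    ∀ᶠ w : HeightOneSpectrum (𝓞 E) in cofinite, algebraMap E (w.adicCompletion E) x ∈ w.adicCompletionIntegers E := by
  by_cases hx : x = 0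
  · subst hx
    exact Filter.Eventually.of_forall fun w => by rw [map_zero]; exact zero_mem _
  · filter_upwards [UnitaryGroup.eventually_valued_algebraMap_eq_one (E := E) hx] with w hw
    rw [HeightOneSpectrum.mem_adicCompletionIntegers, hw]

/-- **A polynomial over `E` has an integral model at almost every place**: `∀ᶠ w, ∃ q ∈ 𝒪_w[X], q ⊗ 1 = p ⊗ 1` in `E_w[X]`.
[cite: PlatonovRapinchuk1994, §5.1] -/
theorem eventually_exists_map_eq_map (p : E[X]) :
    ∀ᶠ w : HeightOneSpectrum (𝓞 E) in cofinite, ∃ q : (w.adicCompletionIntegers E)[X],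
      q.map (w.adicCompletionIntegers E).subtype = p.map (algebraMap E (w.adicCompletion E)) := by
  have h : ∀ᶠ w : HeightOneSpectrum (𝓞 E) in cofinite, ∀ n ∈ p.support,
      algebraMap E (w.adicCompletion E) (p.coeff n) ∈ w.adicCompletionIntegers E :=
    (p.support.eventually_all).2 fun n _ => eventually_mem_adicCompletionIntegers (p.coeff n)
  filter_upwards [h] with w hw
  rw [← Polynomial.mem_lifts, Polynomial.lifts_iff_coeff_lifts]
  intro n
  rw [Polynomial.coeff_map]
  by_cases hn : n ∈ p.support
  · exact ⟨⟨_, hw n hn⟩, rfl⟩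
  · rw [Polynomial.notMem_support_iff.1 hn, map_zero]
    exact ⟨0, map_zero _⟩

/-- **A separable polynomial has a SEPARABLE INTEGRAL MODEL at almost every place**: for `p ∈ E[X]` separable, for all but finitely many `w`
there is `p̃ ∈ 𝒪_w[X]` with `p̃ ⊗ 1 = p ⊗ 1` and `p̃` separable over `𝒪_w` (the Bezout identity `a p + b p′ = 1` has integral coefficients at
almost every `w`), so that its reduction modulo `𝔪_w` is separable (★ `Polynomial.Separable.map`) — «`1 − α(γ)` is a unit or zero for all roots
at almost every place» for a global regular semisimple `γ`. [cite: Kottwitz1986, Cor. 7.3] -/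
theorem eventually_exists_separable_lift (p : E[X]) (hp : p.Separable) :
    ∀ᶠ w : HeightOneSpectrum (𝓞 E) in cofinite, ∃ q : (w.adicCompletionIntegers E)[X],
      q.map (w.adicCompletionIntegers E).subtype = p.map (algebraMap E (w.adicCompletion E)) ∧ q.Separable := by
  obtain ⟨a, b, hab⟩ := hp
  filter_upwards [eventually_exists_map_eq_map p, eventually_exists_map_eq_map a, eventually_exists_map_eq_map b] with w hpw haw hbw
  obtain ⟨q, hq⟩ := hpw
  obtain ⟨a', ha'⟩ := haw
  obtain ⟨b', hb'⟩ := hbw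
  refine ⟨q, hq, a', b', ?_⟩
  apply Polynomial.map_injective (w.adicCompletionIntegers E).subtype Subtype.val_injective
  rw [Polynomial.map_add, Polynomial.map_mul, Polynomial.map_mul, ← Polynomial.derivative_map, ha', hb', hq, Polynomial.map_one,
    Polynomial.derivative_map, ← Polynomial.map_mul, ← Polynomial.map_mul, ← Polynomial.map_add, hab, Polynomial.map_one]

end Integers

/-! ## §2 The split place: `localSplitEquiv` reads `γ ⊗ 1` as `γ ∈ GL_N(E_w)`; the orbit set transported -/

namespace UnitaryGroup

section Split

variable {F E : Type} [Field F] [NumberField F] [Field E] [NumberField E] [Algebra F E]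
  (c : E ≃ₐ[F] E) (N : ℕ) (J : Matrix (Fin N) (Fin N) E)

variable [Algebra.IsQuadraticExtension F E] {v : HeightOneSpectrum (𝓞 F)}

/-- **`localSplitEquiv (γ ⊗ 1) = γ` in `GL_N(E_w)`**: for `g ∈ U(J)(F_v)` with `(g : GL_N(E ⊗ F_v)) = γ ⊗ 1` (★ `toLocalGL`), the split-place
isomorphism sends `g` to `γ` read in `GL_N(E_w)`. [cite: PlatonovRapinchuk1994, §5.1] -/
theorem localSplitEquiv_eq_map_of_eq_toLocalGL (hc : c ≠ 1) (hJh : (J.map c)ᵀ = J) (w : PlacesOver E v) (hw : c • w.1 ≠ w.1)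
    (hJw : IsUnit (placeForm J w.1)) (γ : GL (Fin N) E) (g : «local» E c N J v)
    (hg : (g : GL (Fin N) (LocalRing E v)) = toLocalGL E v γ) :
    localSplitEquiv c J hc hJh w hw hJw g = Matrix.GeneralLinearGroup.map (algebraMap E (w.1.adicCompletion E)) γ := by
  refine Units.ext ?_
  rw [coe_localSplitEquiv_apply, hg, coe_toLocalGL_apply, Matrix.map_map]
  rfl

/-- **Kottwitz's orbit lemma at a split place.**  Let `w ∣ v` with `c • w ≠ w`, `J_w ∈ GL_N(𝒪_w)`, and `g = γ ⊗ 1 ∈ U(J)(F_v)` (`γ ∈ GL_N(E)`)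
with `γ_w ∈ GL_N(𝒪_w)` and an integral model `q ∈ 𝒪_w[X]` of the characteristic polynomial of `γ` that is separable modulo `𝔪_w`.  Then every
`y ∈ U(J)(F_v)` with `y g y⁻¹ ∈ U(J)(𝒪_v)` lies in `U(J)(𝒪_v) · Z(g)` — transport of ★ `mem_range_map_mul_centralizer_of_conj_mem_range` (the
`GL_N(E_w)` statement over the local ring `𝒪_w`) along ★ `localSplitEquiv` ∕ ★ `mem_localIntegralLevel_iff_of_ne`. [cite: Kottwitz1986, Prop. 7.1] -/
theorem orbitSet_of_split (hc : c ≠ 1) (hJh : (J.map c)ᵀ = J) (w : PlacesOver E v) (hw : c • w.1 ≠ w.1) (hJw : IsUnit (placeForm J w.1))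
    (hJi : hJw.unit ∈ glInt N (w.1.adicCompletion E)) (γ : GL (Fin N) E) (g : «local» E c N J v)
    (hg : (g : GL (Fin N) (LocalRing E v)) = toLocalGL E v γ)
    (hγw : Matrix.GeneralLinearGroup.map (algebraMap E (w.1.adicCompletion E)) γ ∈ glInt N (w.1.adicCompletion E))
    (hsep : ∃ q : (w.1.adicCompletionIntegers E)[X],
      q.map (w.1.adicCompletionIntegers E).subtype = (γ : Matrix (Fin N) (Fin N) E).charpoly.map (algebraMap E (w.1.adicCompletion E)) ∧
        (q.map (IsLocalRing.residue (w.1.adicCompletionIntegers E))).Separable) :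
    ∀ y : «local» E c N J v, y * g * y⁻¹ ∈ localIntegralLevel c N J v →
      y ∈ (localIntegralLevel c N J v : Set («local» E c N J v)) * (Subgroup.centralizer ({g} : Set («local» E c N J v)) : Set («local» E c N J v)) := by
  -- the integral lift `γ̃ ∈ GL_N(𝒪_w)` of `γ_w`
  obtain ⟨γw, hγw'⟩ := (mem_range_map_adicCompletionIntegers_iff_mem_glInt N w.1 _).2 hγw
  obtain ⟨q, hq, hqsep⟩ := hsep
  -- its characteristic polynomial is the integral model `q`
  have hchar : (γw : Matrix (Fin N) (Fin N) (w.1.adicCompletionIntegers E)).charpoly = q := by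
    apply Polynomial.map_injective (w.1.adicCompletionIntegers E).subtype Subtype.val_injective
    rw [hq, ← Matrix.charpoly_map, ← Matrix.charpoly_map]
    congr 1
    have h := congrArg (fun u : GL (Fin N) (w.1.adicCompletion E) => (u : Matrix (Fin N) (Fin N) (w.1.adicCompletion E))) hγw'
    exact h
  have hsep' : ((γw : Matrix (Fin N) (Fin N) (w.1.adicCompletionIntegers E)).charpoly.map
      (IsLocalRing.residue (w.1.adicCompletionIntegers E))).Separable := by
    rw [hchar]; exact hqsep
  -- the `GL_N(E_w)` statement
  have hGL := Literature.LinearAlgebra.Matrix.mem_range_map_mul_centralizer_of_conj_mem_range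
    (w.1.adicCompletionIntegers E).subtype Subtype.val_injective γw hsep'
  -- transport along `localSplitEquiv`
  refine orbitSet_of_mulEquiv (localSplitEquiv c J hc hJh w hw hJw).toMulEquiv (localIntegralLevel c N J v)
    (glInt N (w.1.adicCompletion E)) (fun g' => mem_localIntegralLevel_iff_of_ne c N J hc hJh w hw hJw hJi g') g fun y' hy' => ?_
  have he : (localSplitEquiv c J hc hJh w hw hJw).toMulEquiv g = Matrix.GeneralLinearGroup.map (w.1.adicCompletionIntegers E).subtype γw := by
    rw [hγw']
    exact localSplitEquiv_eq_map_of_eq_toLocalGL c N J hc hJh w hw hJw γ g hg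
  have hKeq : ((Matrix.GeneralLinearGroup.map (n := Fin N) (w.1.adicCompletionIntegers E).subtype).range :
        Set (GL (Fin N) (w.1.adicCompletion E))) = (glInt N (w.1.adicCompletion E) : Set (GL (Fin N) (w.1.adicCompletion E))) :=
    Set.ext fun g' => mem_range_map_adicCompletionIntegers_iff_mem_glInt N w.1 g'
  rw [he] at hy' ⊢
  rw [← hKeq]
  exact hGL y' ((mem_range_map_adicCompletionIntegers_iff_mem_glInt N w.1 _).2 hy')

/-! ## §3 Almost every place: every split place over it -/

/-- **Kottwitz's orbit lemma at almost every place, for the split places over it.**  For `c ≠ 1`, a `c`-hermitian `J` with `det J` a unit,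
and `γ ∈ GL_N(E)` with SEPARABLE characteristic polynomial such that `γ ⊗ 1 ∈ U(J)(F_v)` for every `v` (the elements `g v`): for all but finitely
many `v` — off the places where `J_w ∉ GL_N(𝒪_w)` (★ `eventually_forall_unit_placeForm_mem_glInt`), `γ_w ∉ GL_N(𝒪_w)` (★ `eventually_forall_map_mem_glInt`)
or the characteristic polynomial has no separable integral model (`eventually_exists_separable_lift`) — at EVERY split `w ∣ v`,
`∀ y ∈ U(J)(F_v), y (γ ⊗ 1) y⁻¹ ∈ U(J)(𝒪_v) → y ∈ U(J)(𝒪_v) · Z(γ ⊗ 1)`. [cite: Kottwitz1986, Prop. 7.1; Cor. 7.3] -/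
theorem eventually_forall_orbitSet_of_split (hc : c ≠ 1) (hJh : (J.map c)ᵀ = J) (hJ : IsUnit J.det) (γ : GL (Fin N) E)
    (hγ : ((γ : Matrix (Fin N) (Fin N) E).charpoly).Separable) (g : ∀ v : HeightOneSpectrum (𝓞 F), «local» E c N J v)
    (hg : ∀ v, (g v : GL (Fin N) (LocalRing E v)) = toLocalGL E v γ) :
    ∀ᶠ v : HeightOneSpectrum (𝓞 F) in cofinite, ∀ w : PlacesOver E v, c • w.1 ≠ w.1 →
      ∀ y : «local» E c N J v, y * g v * y⁻¹ ∈ localIntegralLevel c N J v →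
        y ∈ (localIntegralLevel c N J v : Set («local» E c N J v)) *
          (Subgroup.centralizer ({g v} : Set («local» E c N J v)) : Set («local» E c N J v)) := by
  have hJu : IsUnit J := (Matrix.isUnit_iff_isUnit_det J).2 hJ
  filter_upwards [eventually_forall_unit_placeForm_mem_glInt (F := F) N J hJu, eventually_forall_map_mem_glInt F E γ,
    eventually_forall_placesOver E (eventually_exists_separable_lift ((γ : Matrix (Fin N) (Fin N) E).charpoly) hγ)]
    with v hint hγint hsep w hw
  obtain ⟨q, hq, hqsep⟩ := hsep w
  exact orbitSet_of_split c N J hc hJh w hw (isUnit_placeForm J hJu w.1) (hint w) γ (g v) (hg v) (hγint w) ⟨q, hq, hqsep.map⟩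

end Split

/-! ## §4 The CM dress: `(cmDatum L N H).Local v`, `cmLocalIntegralLevel`, rational `γ ∈ U(H)(L⁺)` -/

section CM

variable (L : Type) [Field L] [NumberField L] [IsCMField L] (N : ℕ) (H : Matrix (Fin N) (Fin N) L)

/-- **`γ_v = γ ⊗ 1`**: the local component at `v` of the diagonal image of a rational `γ ∈ U(H)(L⁺)` is `γ` read in `GL_N(L ⊗ L⁺_v)`
(★ `coe_cmDatum_toLocal`, ★ `coe_cmDatum_toAdelic`, ★ `adeleToLocal_comp_algebraMap`). [cite: PlatonovRapinchuk1994, §5.1] -/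
theorem coe_cmDatum_toLocal_toAdelic (v : HeightOneSpectrum (𝓞 ↥(maximalRealSubfield L))) (γ : (cmDatum L N H).Rational) :
    (((cmDatum L N H).toLocal v ((cmDatum L N H).toAdelic γ)).val : GL (Fin N) (LocalRing L v)) =
      toLocalGL L v (γ.val : GL (Fin N) L) := by
  refine Units.ext ?_
  rw [coe_cmDatum_toLocal, coe_cmDatum_toAdelic, coe_toLocalGL_apply]
  change (((γ.val : GL (Fin N) L) : Matrix (Fin N) (Fin N) L).map (algebraMap L (AdeleRing (𝓞 L) L))).map (adeleToLocal L v) =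
    ((γ.val : GL (Fin N) L) : Matrix (Fin N) (Fin N) L).map (algebraMap L (LocalRing L v))
  rw [Matrix.map_map, ← adeleToLocal_comp_algebraMap L v, RingHom.coe_comp]

/-- **The SPLIT half of `UnramifiedOrbitSetAE L N H`.**  For a hermitian `H` with `det H ≠ 0` and a regular semisimple rational
`γ ∈ U(H)(L⁺)` (separable characteristic polynomial — ★ `Rogawski1990.IsRegularElt γ.val` unfolds to this, `Iff.rfl`): for all but finitely many
finite places `v` of `L⁺`, at every place `w ∣ v` of `L` SPLIT over `v`
(`c̄ • w ≠ w`), every `y ∈ U(H)(L⁺_v)` with `y γ_v y⁻¹ ∈ K_v = U(H)(𝒪_v)` lies in `K_v · Z(γ_v)`. [cite: Kottwitz1986, Prop. 7.1; Cor. 7.3]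
[cite: Rogawski1990, §3.3 p. 21; §4.3 p. 44] -/
theorem eventually_forall_orbitSet_cmDatum_of_split (hH : (H.map (cmConjRingHom L))ᵀ = H) (hHd : H.det ≠ 0)
    (γ : (cmDatum L N H).Rational) (hγ : (((γ.val : GL (Fin N) L) : Matrix (Fin N) (Fin N) L).charpoly).Separable) :
    ∀ᶠ v : HeightOneSpectrum (𝓞 ↥(maximalRealSubfield L)) in cofinite, ∀ w : PlacesOver L v, IsCMField.complexConj L • w.1 ≠ w.1 →
      ∀ y : (cmDatum L N H).Local v,
        y * (cmDatum L N H).toLocal v ((cmDatum L N H).toAdelic γ) * y⁻¹ ∈ cmLocalIntegralLevel L N H v →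
          y ∈ (cmLocalIntegralLevel L N H v : Set ((cmDatum L N H).Local v)) *
            (Subgroup.centralizer ({(cmDatum L N H).toLocal v ((cmDatum L N H).toAdelic γ)} : Set ((cmDatum L N H).Local v)) :
              Set ((cmDatum L N H).Local v)) :=
  eventually_forall_orbitSet_of_split (IsCMField.complexConj L) N H (IsCMField.complexConj_ne_one L) hH (isUnit_iff_ne_zero.2 hHd)
    (γ.val : GL (Fin N) L) hγ (fun v => (cmDatum L N H).toLocal v ((cmDatum L N H).toAdelic γ))
    (fun v => coe_cmDatum_toLocal_toAdelic L N H v γ)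

end CM

end UnitaryGroup

end Literature.NumberTheory.Automorphic

end
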